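import Literature.MathematicalPhysics.QuantumFieldTheory.Balaban1983to89.T4StabilityFloor
import Literature.MathematicalPhysics.QuantumFieldTheory.Balaban1983to89.Node00.Record13SepCoPH
import Summits.QuantumFields.YangMills.Theorems.BalabanUVNodesN13UVRowOfUpperAndSmallLocus

/-!
# BalabanUVNodes ∕ N13 — THE LADDER'S (G2)∕(G5) STABILITY SOCKET READS N13's (UV₁₃) ROW ONLY AT THE TOP LEVEL `k = K`, ONLY ITS LOWER HALF, WITH ONE NUMBER:
# `LowEnvelope` at K1⁷'s record from the all-small term's lower bound (L2ˢ) AT THE FINAL SCALE of the tuned runs — no (U1), no (U2), no level `k < K`, no `Cor3With`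

Cell `pub-ymgap` (HUMAN RULING D-0062 Track A; D-0149 width seat `pub-ymgap-dag-n13-w1`, g3, CLAIM-3), key K1⁷ `StabilityBAtRecordR13SepCoPH` = stmt-QuantumFields-20542
(`--kind proof --supports … --as helper`).  [III] = [Balaban1988Convergent], [B16] = [Balaban1989LargeFieldII], [B10] = [Balaban1985UV3], [Av] = [Balaban1985Averaging].

WHY THIS FILE.  The rung `BalabanLadder.UV` consumes (B) through the ladder's stability socket `T4StabilitySocket.lowEnvelope_of_cor3With` (dag-n13-w3's capstone
`…N13StabilitySocketOfLeavesAtRecord13SepCoPH.lowEnvelope_datumOfRecord₁₃SepCoPH_of_U1_U2_L2`, p597689, feeds it `Cor3With` at the record from the three N13 leaves U1∕U2∕L2 at EVERY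
level `k ≤ K`).  READING THE SOCKET'S PROOF (`dressed_lower` ∘ `exp_neg_mul_smallFieldMass_le_integral_dens`): of the whole two-sided, all-level, pointwise statement (2.50) it uses
EXACTLY the LOWER inequality at the FINAL level `k = K` of the run `⟨κ K, m, g₀(κ K)⟩`, integrated against the product Haar measure of the unit lattice `T₁^{(K)}` — whose site count
is the `K`-independent number `(2L^m)⁴` — then [B10] (6) `∫ρ_K dV_K = ∫ρ₀ dU` and source monotonicity.  The upper half, the levels `k < K`, the dependence FUNCTION `e₋(·)` away
from the tuned value and (U1)∕(U2) altogether play no role in (G2)∕(G5).  THIS FILE types that reading as a socket with the weaker key and instantiates it at NODE 00's Stage-13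
record: §1 (generic `D : FiniteEpsData F G`) `exp_neg_mul_smallFieldMass_le_integral_dens_of_lowerAtTop`, `dressed_lower_of_lowerAtTop`, ★ `lowEnvelope_of_lowerAtTop` — the
(G2)∕(G5) socket from ONE NUMBER `Em` and the pointwise lower half AT THE TOP LEVEL of the runs `κ K`, `K ≥ K₀` (no window, no tuning, no `Cor3With`); the floor module's
(`T4StabilityFloor`) core ∕ bond-ball forms re-keyed the same way — `exp_neg_mul_measureReal_le_integral_dens_of_lowerAtTop`, `dressed_lower_core_of_lowerAtTop`,
★ `lowEnvelope_of_lowerAtTop_core`, ★ `lowEnvelope_of_lowerAtTop_ball` (EXPLICIT `K`-uniform floor `e^{−a∕g²}·haar(B)^{4(2L^m)⁴}` from (P1)∕(P2) on a bond ball); §2 (the record,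
`θ : Stage13HParams F N`, `h : θ.Provisos₁₃SepCoPH F N`, N-generic) `uvLowerTop_datumOfRecord₁₃SepCoPH_of_L2smallTop` — the top-level pointwise lower half at the record from the
all-small term's lower bound (L2ˢ) demanded ONLY at `k = K` and ONLY on the small locus `{V : every b₀-free plaquette (2εreg + 4ε₂₉)-small}` (dag-n13-w1 g2's `uvLower_of_smallLocus`:
off the locus the (2.9) species vanishes, `ρ_K ≥ 0`), ★★ `lowEnvelope_datumOfRecord₁₃SepCoPH_of_L2smallTop` — the ladder's socket at K1⁷'s record from (L2ˢ) AT THE TOP LEVEL with one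
number `Em`, `εreg` in [Av] Prop. 2's range, and the socket's external binders (α) `hα`, (γ) `hfloor`, numerator envelope; `hsign` ∕ `hsites` discharged as in p597689; and its
bond-ball twin ★★ `lowEnvelope_datumOfRecord₁₃SepCoPH_of_L2smallTop_ball` with the floor EXPLICIT from (P1) `χβ_K ≥ 1` ∕ (P2) `A^η_K ≤ a` on a bond ball (displayed).
RELATION TO CLAIM-1∕2 (`…N13UVRowDepthIndexedAtRecord13`, p600126; `…N13Cor3AtRecordOfDepthIndexedLeaves`): there the budgets were indexed by the remaining depth `K − k`; the socket
lives at remaining depth ZERO, where the volume `|T₁^{(K)}| = (2L^m)⁴` is constant — so for the rung even the coupling-dependence of `e₋` collapses to its value on the tuned family.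
What the rung asks of N13 is therefore: a `K`-UNIFORM lower bound for the all-small (2.18) term of the FULLY INTEGRATED density on the unit lattice of the physical torus, on
small fields — the partition-function face of UV stability ([B10] remark (6)), nothing more.  LOCATED READING for the planners; K1⁷ as filed still demands the full (B).

HONEST FRAMING.  Count-neutral socket bookkeeping (the ladder module's own lemmas `exp_neg_mul_integral_le_of_pointwise` ∕ `integrable_dens_top` ∕ `integral_dens_eq_zero` ∕
`exp_neg_mul_integral_dens_zero_le` ∕ `constOf_mul_nlowOf`, re-keyed) + dag-n13-w1 g2's small-locus junction; (L2ˢ) at the top level, (α), (γ) and the numerator envelope are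
DISPLAYED — nothing of [B16] Thm 1 ∕ [III] Cor. 3 ∕ Thm 2 claimed; N13 NOT discharged; K0⁷∕K1⁷ NOT closed; counts unmoved (5∕27 · A 5∕28); one finite `𝕋⁴_{L^K}` programme at
fixed `ε = L^{−K}` — R4 closes the conditional finite-𝕋⁴ rung `BalabanLadder.UV` only; the YM mass gap (Clay) is NOT proved by any of this.  No `def`, no `sorry`, no `instance`.
-/

noncomputable section

open MeasureTheory
open scoped BigOperators Matrix.Norms.L2Operator

namespace Summit.QuantumFields.YangMills.BalabanUVNodes.N13StabilitySocketOfTopLevelLowerAtRecord13SepCoPH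

open Literature.MathematicalPhysics.QuantumFieldTheory.Balaban1983to89
open Literature.MathematicalPhysics.QuantumFieldTheory.Balaban1983to89.T4Continuum (T4Family FiniteEpsData)
open Literature.MathematicalPhysics.QuantumFieldTheory.Balaban1983to89.Node00
open Literature.MathematicalPhysics.QuantumFieldTheory.Balaban1983to89.T4StabilitySocket
open Literature.MathematicalPhysics.QuantumFieldTheory.Balaban1983to89.T4StabilityFloor
  (exp_neg_mul_measureReal_le_integral_of_pointwise bondBall measurableSet_bondBall fieldMeasure_real_bondBall_top unitBondCount floorOf floorOf_pos)
open ExpMeanLog (deltaSU)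
open B14Cor3 (ge_of_sum_repr)
open Summit.QuantumFields.YangMills.BalabanUVNodes.N13Cor3Repr218LeavesAtRecord13CoPH (densOfRecord₁₃_eq_sum)
open Summit.QuantumFields.YangMills.BalabanUVNodes.N13UVChiOffSolvableAtRecord13 (histTerm_nonneg uvLower_of_smallLocus)

/-! ## §1 The (G2)∕(G5) socket keyed on the top-level lower half only (generic `FiniteEpsData`) -/

section Generic

variable {F : T4Family} {G : Type*} [GaugeGroup G] [MeasurableSpace G] [HaarData G] [RegularGaugeGroup G]

/-- **(2.50)-LOWER AT THE FINAL SCALE, INTEGRATED — from the top-level lower half ALONE**: if `χ_K ≥ 0` and at every unit-lattice configuration of the run `⟨K, m, g₀⟩`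
`χ_K·exp(−g_K⁻²A − Em·|T₁^{(K)}|) ≤ ρ_K`, then `exp(−Em·|T₁^{(K)}|)·c_low(K) ≤ ∫ρ_K dV_K` (the ladder module's `exp_neg_mul_smallFieldMass_le_integral_dens` with its `Cor3With` key
replaced by what it reads). [cite: Balaban1988Convergent, Cor. 3 (2.50) p.264; Balaban1985UV3, (6) p.257] -/
theorem exp_neg_mul_smallFieldMass_le_integral_dens_of_lowerAtTop (D : FiniteEpsData F G) (hsign : B16.SignConventions D.C) (K : ℕ) (g₀ : ℝ) {Em : ℝ}
    (hlow : ∀ V : GaugeField (F.P K) K G,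
      (D.C ⟨K, F.m, g₀⟩).χ K ((D.real.cfg K g₀ K).symm V) *
          Real.exp (-(1 / ((D.C ⟨K, F.m, g₀⟩).flow.g K) ^ 2 * (D.C ⟨K, F.m, g₀⟩).wilsonBG K ((D.real.cfg K g₀ K).symm V)) -
            Em * ((D.C ⟨K, F.m, g₀⟩).numSites K : ℝ)) ≤ D.dens K g₀ K V) :
    Real.exp (-(Em * ((D.C ⟨K, F.m, g₀⟩).numSites K : ℝ))) * smallFieldMass D K g₀ ≤ ∫ V, D.dens K g₀ K V ∂fieldMeasure (F.P K) K G :=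
  exp_neg_mul_integral_le_of_pointwise (μ := fieldMeasure (F.P K) K G)
    (S := fun V => 1 / ((D.C ⟨K, F.m, g₀⟩).flow.g K) ^ 2 * (D.C ⟨K, F.m, g₀⟩).wilsonBG K ((D.real.cfg K g₀ K).symm V))
    (fun _ => hsign _ _ _) hlow (integrable_dens_top D K g₀)

/-- **THE (G2) CHAIN OF ONE RUN from the top-level lower half ALONE**: `e^{−|t|B}·(e^{−Em·|T₁^{(K)}|}·c_low(K)) ≤ ∫ e^{tF(U)} ρ₀(U) dU` — [B10] (6) `∫ρ_K dV_K = ∫ρ₀ dU`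
(`FiniteEpsData.integral_dens_eq_zero`) and source monotonicity (`exp_neg_mul_integral_dens_zero_le`) after §1's integrated bound. [cite: Balaban1985UV3, (6) p.257; Balaban1988Convergent, Cor. 3 (2.50) p.264] -/
theorem dressed_lower_of_lowerAtTop (D : FiniteEpsData F G) (hsign : B16.SignConventions D.C) (K : ℕ) (g₀ : ℝ) {Em : ℝ}
    (hlow : ∀ V : GaugeField (F.P K) K G,
      (D.C ⟨K, F.m, g₀⟩).χ K ((D.real.cfg K g₀ K).symm V) *
          Real.exp (-(1 / ((D.C ⟨K, F.m, g₀⟩).flow.g K) ^ 2 * (D.C ⟨K, F.m, g₀⟩).wilsonBG K ((D.real.cfg K g₀ K).symm V)) -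
            Em * ((D.C ⟨K, F.m, g₀⟩).numSites K : ℝ)) ≤ D.dens K g₀ K V)
    {obs : GaugeField (F.P K) 0 G → ℝ} {B : ℝ} (hobs : Measurable obs) (hbd : ∀ U, |obs U| ≤ B) (t : ℝ) :
    Real.exp (-(|t| * B)) * (Real.exp (-(Em * ((D.C ⟨K, F.m, g₀⟩).numSites K : ℝ))) * smallFieldMass D K g₀) ≤
      ∫ U, Real.exp (t * obs U) * D.dens K g₀ 0 U ∂fieldMeasure (F.P K) 0 G :=
  calc Real.exp (-(|t| * B)) * (Real.exp (-(Em * ((D.C ⟨K, F.m, g₀⟩).numSites K : ℝ))) * smallFieldMass D K g₀)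
      ≤ Real.exp (-(|t| * B)) * ∫ V, D.dens K g₀ K V ∂fieldMeasure (F.P K) K G :=
        mul_le_mul_of_nonneg_left (exp_neg_mul_smallFieldMass_le_integral_dens_of_lowerAtTop D hsign K g₀ hlow) (Real.exp_nonneg _)
    _ = Real.exp (-(|t| * B)) * ∫ U, D.dens K g₀ 0 U ∂fieldMeasure (F.P K) 0 G := by rw [D.integral_dens_eq_zero K g₀ K le_rfl]
    _ ≤ _ := exp_neg_mul_integral_dens_zero_le D K g₀ hobs hbd t

/-- **★ THE (G2)∕(G5) SOCKET FROM THE TOP-LEVEL LOWER HALF WITH ONE NUMBER.**  One `FiniteEpsData` `D` with `χ_k ≥ 0`, a run-index map `κ`, bare couplings `g₀`, and — in place of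
the socket's `Cor3With` key — ONE number `Em` with the pointwise lower inequality of (2.50) at the FINAL level `k = κ K` of the run `⟨κ K, m, g₀(κ K)⟩` for `K ≥ K₀`; the external
binders (α) `hα`, (γ) `hfloor`, the site budget `hsites` and the numerator envelope exactly as in `T4StabilitySocket.lowEnvelope_of_cor3With`.  Conclusion: the same `LowEnvelope` with
`e₋⁺ := max Em 0`.  No window, no tuning, no upper half, no level `k < K`. [cite: Balaban1988Convergent, Cor. 3 (2.50) p.264; Balaban1985UV3, (6) p.257] -/
theorem lowEnvelope_of_lowerAtTop (D : FiniteEpsData F G) (hsign : B16.SignConventions D.C) (κ : ℕ → ℕ) (g₀ : ℕ → ℝ) {Em : ℝ} {K₀ : ℕ}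
    (hlow : ∀ K, K₀ ≤ K → ∀ V : GaugeField (F.P (κ K)) (κ K) G,
      (D.C ⟨κ K, F.m, g₀ (κ K)⟩).χ (κ K) ((D.real.cfg (κ K) (g₀ (κ K)) (κ K)).symm V) *
          Real.exp (-(1 / ((D.C ⟨κ K, F.m, g₀ (κ K)⟩).flow.g (κ K)) ^ 2 *
              (D.C ⟨κ K, F.m, g₀ (κ K)⟩).wilsonBG (κ K) ((D.real.cfg (κ K) (g₀ (κ K)) (κ K)).symm V)) -
            Em * ((D.C ⟨κ K, F.m, g₀ (κ K)⟩).numSites (κ K) : ℝ)) ≤ D.dens (κ K) (g₀ (κ K)) (κ K) V)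
    {obs : (K : ℕ) → GaugeField (F.P K) 0 G → ℝ} {B l₀ : ℝ}
    (hobs : ∀ K, Measurable (obs K)) (hbd : ∀ K U, |obs K U| ≤ B)
    {ι : Type*} {T : ℕ → Finset ι} {A : ℕ → ℝ → ι → ℝ}
    (hα : ∀ K t, |t| ≤ l₀ → K₀ ≤ K →
      ∫ U, Real.exp (t * obs (κ K) U) * D.dens (κ K) (g₀ (κ K)) 0 U ∂fieldMeasure (F.P (κ K)) 0 G ≤ ∑ τ ∈ T K, A K t τ)
    {c₀ n₁ : ℝ} (hc₀ : 0 < c₀) (hfloor : ∀ K, K₀ ≤ K → c₀ ≤ smallFieldMass D (κ K) (g₀ (κ K)))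
    (hsites : ∀ K, K₀ ≤ K → ((D.C ⟨κ K, F.m, g₀ (κ K)⟩).numSites (κ K) : ℝ) ≤ n₁)
    {nup : ℕ → ℝ → ℝ} {Nup : ℝ} (hnup : ∀ K t, |t| ≤ l₀ → K₀ ≤ K → 0 ≤ nup K t ∧ nup K t ≤ Nup) :
    LowEnvelope l₀ T A (nlowOf l₀ B (max Em 0) n₁ c₀) nup (constOf l₀ B (max Em 0) n₁ c₀ Nup) K₀ where
  low K t ht hK := by
    have hB0 : 0 ≤ B := (abs_nonneg _).trans (hbd (κ K) 1)
    have hchain := dressed_lower_of_lowerAtTop D hsign (κ K) (g₀ (κ K)) (hlow K hK) (hobs (κ K)) (hbd (κ K)) t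
    have hn0 : 0 ≤ ((D.C ⟨κ K, F.m, g₀ (κ K)⟩).numSites (κ K) : ℝ) := Nat.cast_nonneg _
    have h1 : |t| * B ≤ l₀ * B := mul_le_mul_of_nonneg_right ht hB0
    have h2 : Em * ((D.C ⟨κ K, F.m, g₀ (κ K)⟩).numSites (κ K) : ℝ) ≤ max Em 0 * ((D.C ⟨κ K, F.m, g₀ (κ K)⟩).numSites (κ K) : ℝ) :=
      mul_le_mul_of_nonneg_right (le_max_left _ _) hn0
    have h3 : max Em 0 * ((D.C ⟨κ K, F.m, g₀ (κ K)⟩).numSites (κ K) : ℝ) ≤ max Em 0 * n₁ :=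
      mul_le_mul_of_nonneg_left (hsites K hK) (le_max_right _ _)
    calc nlowOf l₀ B (max Em 0) n₁ c₀ K t = Real.exp (-(l₀ * B + max Em 0 * n₁)) * c₀ := rfl
      _ ≤ Real.exp (-(|t| * B)) * (Real.exp (-(Em * ((D.C ⟨κ K, F.m, g₀ (κ K)⟩).numSites (κ K) : ℝ))) * smallFieldMass D (κ K) (g₀ (κ K))) := by
          rw [← mul_assoc, ← Real.exp_add]
          exact mul_le_mul (Real.exp_le_exp.mpr (by linarith)) (hfloor K hK) hc₀.le (Real.exp_nonneg _)
      _ ≤ ∫ U, Real.exp (t * obs (κ K) U) * D.dens (κ K) (g₀ (κ K)) 0 U ∂fieldMeasure (F.P (κ K)) 0 G := hchain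
      _ ≤ ∑ τ ∈ T K, A K t τ := hα K t ht hK
  nup_nonneg K t ht hK := (hnup K t ht hK).1
  ratio K t ht hK := by
    rw [constOf_mul_nlowOf hc₀.ne']
    exact (hnup K t ht hK).2

/-- **(2.50)-LOWER AT THE FINAL SCALE ON A CORE SET, from the top-level lower half ALONE** (the floor module's `exp_neg_mul_measureReal_le_integral_dens` re-keyed): on a measurable
`S` with (P1) `χ_K ≥ 1` and (P2) `A(U_K ·) ≤ a`, `exp[−(a∕g_K² + Em·|T₁^{(K)}|)]·μ_K(S) ≤ ∫ρ_K dV_K` — no measurability of `χ_K`, `A` needed. [cite: Balaban1988Convergent, Cor. 3 (2.50) p.264; Balaban1985UV3, (6) p.257] -/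
theorem exp_neg_mul_measureReal_le_integral_dens_of_lowerAtTop (D : FiniteEpsData F G) (hsign : B16.SignConventions D.C) (K : ℕ) (g₀ : ℝ) {Em : ℝ}
    (hlow : ∀ V : GaugeField (F.P K) K G,
      (D.C ⟨K, F.m, g₀⟩).χ K ((D.real.cfg K g₀ K).symm V) *
          Real.exp (-(1 / ((D.C ⟨K, F.m, g₀⟩).flow.g K) ^ 2 * (D.C ⟨K, F.m, g₀⟩).wilsonBG K ((D.real.cfg K g₀ K).symm V)) -
            Em * ((D.C ⟨K, F.m, g₀⟩).numSites K : ℝ)) ≤ D.dens K g₀ K V)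
    {S : Set (GaugeField (F.P K) K G)} (hS : MeasurableSet S) {a : ℝ}
    (hχ : ∀ V ∈ S, 1 ≤ (D.C ⟨K, F.m, g₀⟩).χ K ((D.real.cfg K g₀ K).symm V))
    (hA : ∀ V ∈ S, (D.C ⟨K, F.m, g₀⟩).wilsonBG K ((D.real.cfg K g₀ K).symm V) ≤ a) :
    Real.exp (-(1 / ((D.C ⟨K, F.m, g₀⟩).flow.g K) ^ 2 * a + Em * ((D.C ⟨K, F.m, g₀⟩).numSites K : ℝ))) * (fieldMeasure (F.P K) K G).real S ≤
      ∫ V, D.dens K g₀ K V ∂fieldMeasure (F.P K) K G := by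
  have hg : 0 ≤ 1 / ((D.C ⟨K, F.m, g₀⟩).flow.g K) ^ 2 := by positivity
  exact exp_neg_mul_measureReal_le_integral_of_pointwise (μ := fieldMeasure (F.P K) K G)
    (S := fun V => 1 / ((D.C ⟨K, F.m, g₀⟩).flow.g K) ^ 2 * (D.C ⟨K, F.m, g₀⟩).wilsonBG K ((D.real.cfg K g₀ K).symm V))
    hS (fun _ => hsign _ _ _) hlow (integrable_dens_top D K g₀) hχ (fun V hV => mul_le_mul_of_nonneg_left (hA V hV) hg)

/-- **THE (G2) CHAIN OF ONE RUN ON A CORE SET, from the top-level lower half ALONE** (`dressed_lower_core` re-keyed). [cite: Balaban1985UV3, (6) p.257; Balaban1988Convergent, Cor. 3 (2.50) p.264] -/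
theorem dressed_lower_core_of_lowerAtTop (D : FiniteEpsData F G) (hsign : B16.SignConventions D.C) (K : ℕ) (g₀ : ℝ) {Em : ℝ}
    (hlow : ∀ V : GaugeField (F.P K) K G,
      (D.C ⟨K, F.m, g₀⟩).χ K ((D.real.cfg K g₀ K).symm V) *
          Real.exp (-(1 / ((D.C ⟨K, F.m, g₀⟩).flow.g K) ^ 2 * (D.C ⟨K, F.m, g₀⟩).wilsonBG K ((D.real.cfg K g₀ K).symm V)) -
            Em * ((D.C ⟨K, F.m, g₀⟩).numSites K : ℝ)) ≤ D.dens K g₀ K V)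
    {S : Set (GaugeField (F.P K) K G)} (hS : MeasurableSet S) {a : ℝ}
    (hχ : ∀ V ∈ S, 1 ≤ (D.C ⟨K, F.m, g₀⟩).χ K ((D.real.cfg K g₀ K).symm V))
    (hA : ∀ V ∈ S, (D.C ⟨K, F.m, g₀⟩).wilsonBG K ((D.real.cfg K g₀ K).symm V) ≤ a)
    {obs : GaugeField (F.P K) 0 G → ℝ} {B : ℝ} (hobs : Measurable obs) (hbd : ∀ U, |obs U| ≤ B) (t : ℝ) :
    Real.exp (-(|t| * B)) *
        (Real.exp (-(1 / ((D.C ⟨K, F.m, g₀⟩).flow.g K) ^ 2 * a + Em * ((D.C ⟨K, F.m, g₀⟩).numSites K : ℝ))) * (fieldMeasure (F.P K) K G).real S) ≤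
      ∫ U, Real.exp (t * obs U) * D.dens K g₀ 0 U ∂fieldMeasure (F.P K) 0 G :=
  calc Real.exp (-(|t| * B)) *
        (Real.exp (-(1 / ((D.C ⟨K, F.m, g₀⟩).flow.g K) ^ 2 * a + Em * ((D.C ⟨K, F.m, g₀⟩).numSites K : ℝ))) * (fieldMeasure (F.P K) K G).real S)
      ≤ Real.exp (-(|t| * B)) * ∫ V, D.dens K g₀ K V ∂fieldMeasure (F.P K) K G :=
        mul_le_mul_of_nonneg_left (exp_neg_mul_measureReal_le_integral_dens_of_lowerAtTop D hsign K g₀ hlow hS hχ hA) (Real.exp_nonneg _)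
    _ = Real.exp (-(|t| * B)) * ∫ U, D.dens K g₀ 0 U ∂fieldMeasure (F.P K) 0 G := by rw [D.integral_dens_eq_zero K g₀ K le_rfl]
    _ ≤ _ := exp_neg_mul_integral_dens_zero_le D K g₀ hobs hbd t

/-- **★ THE FLOORED (G2)∕(G5) SOCKET FROM THE TOP-LEVEL LOWER HALF — core form** (`T4StabilityFloor.lowEnvelope_of_cor3With_core` re-keyed): ONE number `Em`, the pointwise lower half
at `k = κ K`, the endpoint `g_{κ K} = g` of the runs (the tuned value, for the floor's `e^{−a∕g²}`), measurable core sets `S K` of mass `≥ θ > 0` carrying (P1) `χ_K ≥ 1` and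
(P2) `A(U_K ·) ≤ a`; then `LowEnvelope` with the EXPLICIT floor `c₀ = floorOf g a θ = e^{−a∕g²}·θ`.  No window, no `Cor3With`, no level `k < K`. [cite: Balaban1988Convergent, Cor. 3 (2.50) p.264; Balaban1985UV3, (6) p.257] -/
theorem lowEnvelope_of_lowerAtTop_core (D : FiniteEpsData F G) (hsign : B16.SignConventions D.C) (κ : ℕ → ℕ) (g₀ : ℕ → ℝ) {g Em : ℝ} {K₀ : ℕ}
    (hg : ∀ K, K₀ ≤ K → (D.C ⟨κ K, F.m, g₀ (κ K)⟩).flow.g (κ K) = g)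
    (hlow : ∀ K, K₀ ≤ K → ∀ V : GaugeField (F.P (κ K)) (κ K) G,
      (D.C ⟨κ K, F.m, g₀ (κ K)⟩).χ (κ K) ((D.real.cfg (κ K) (g₀ (κ K)) (κ K)).symm V) *
          Real.exp (-(1 / ((D.C ⟨κ K, F.m, g₀ (κ K)⟩).flow.g (κ K)) ^ 2 *
              (D.C ⟨κ K, F.m, g₀ (κ K)⟩).wilsonBG (κ K) ((D.real.cfg (κ K) (g₀ (κ K)) (κ K)).symm V)) -
            Em * ((D.C ⟨κ K, F.m, g₀ (κ K)⟩).numSites (κ K) : ℝ)) ≤ D.dens (κ K) (g₀ (κ K)) (κ K) V)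
    {obs : (K : ℕ) → GaugeField (F.P K) 0 G → ℝ} {B l₀ : ℝ}
    (hobs : ∀ K, Measurable (obs K)) (hbd : ∀ K U, |obs K U| ≤ B)
    {ι : Type*} {T : ℕ → Finset ι} {A : ℕ → ℝ → ι → ℝ}
    (hα : ∀ K t, |t| ≤ l₀ → K₀ ≤ K →
      ∫ U, Real.exp (t * obs (κ K) U) * D.dens (κ K) (g₀ (κ K)) 0 U ∂fieldMeasure (F.P (κ K)) 0 G ≤ ∑ τ ∈ T K, A K t τ)
    {S : (K : ℕ) → Set (GaugeField (F.P (κ K)) (κ K) G)} (hS : ∀ K, MeasurableSet (S K))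
    {a θ n₁ : ℝ} (hθ : 0 < θ) (hmass : ∀ K, K₀ ≤ K → θ ≤ (fieldMeasure (F.P (κ K)) (κ K) G).real (S K))
    (hχ : ∀ K, K₀ ≤ K → ∀ V ∈ S K, 1 ≤ (D.C ⟨κ K, F.m, g₀ (κ K)⟩).χ (κ K) ((D.real.cfg (κ K) (g₀ (κ K)) (κ K)).symm V))
    (hA : ∀ K, K₀ ≤ K → ∀ V ∈ S K, (D.C ⟨κ K, F.m, g₀ (κ K)⟩).wilsonBG (κ K) ((D.real.cfg (κ K) (g₀ (κ K)) (κ K)).symm V) ≤ a)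
    (hsites : ∀ K, K₀ ≤ K → ((D.C ⟨κ K, F.m, g₀ (κ K)⟩).numSites (κ K) : ℝ) ≤ n₁)
    {nup : ℕ → ℝ → ℝ} {Nup : ℝ} (hnup : ∀ K t, |t| ≤ l₀ → K₀ ≤ K → 0 ≤ nup K t ∧ nup K t ≤ Nup) :
    LowEnvelope l₀ T A (nlowOf l₀ B (max Em 0) n₁ (floorOf g a θ)) nup (constOf l₀ B (max Em 0) n₁ (floorOf g a θ) Nup) K₀ where
  low K t ht hK := by
    have hB0 : 0 ≤ B := (abs_nonneg _).trans (hbd (κ K) 1)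
    have hchain := dressed_lower_core_of_lowerAtTop D hsign (κ K) (g₀ (κ K)) (hlow K hK) (hS K) (hχ K hK) (hA K hK) (hobs (κ K)) (hbd (κ K)) t
    rw [hg K hK] at hchain
    have hn0 : 0 ≤ ((D.C ⟨κ K, F.m, g₀ (κ K)⟩).numSites (κ K) : ℝ) := Nat.cast_nonneg _
    have h1 : |t| * B ≤ l₀ * B := mul_le_mul_of_nonneg_right ht hB0
    have h2 : Em * ((D.C ⟨κ K, F.m, g₀ (κ K)⟩).numSites (κ K) : ℝ) ≤ max Em 0 * ((D.C ⟨κ K, F.m, g₀ (κ K)⟩).numSites (κ K) : ℝ) :=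
      mul_le_mul_of_nonneg_right (le_max_left _ _) hn0
    have h3 : max Em 0 * ((D.C ⟨κ K, F.m, g₀ (κ K)⟩).numSites (κ K) : ℝ) ≤ max Em 0 * n₁ :=
      mul_le_mul_of_nonneg_left (hsites K hK) (le_max_right _ _)
    calc nlowOf l₀ B (max Em 0) n₁ (floorOf g a θ) K t
        = Real.exp (-(l₀ * B + max Em 0 * n₁)) * (Real.exp (-(1 / g ^ 2 * a)) * θ) := rfl
      _ = Real.exp (-(l₀ * B + max Em 0 * n₁) + -(1 / g ^ 2 * a)) * θ := by rw [Real.exp_add, mul_assoc]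
      _ ≤ Real.exp (-(|t| * B) + -(1 / g ^ 2 * a + Em * ((D.C ⟨κ K, F.m, g₀ (κ K)⟩).numSites (κ K) : ℝ))) *
            (fieldMeasure (F.P (κ K)) (κ K) G).real (S K) :=
          mul_le_mul (Real.exp_le_exp.mpr (by linarith)) (hmass K hK) hθ.le (Real.exp_nonneg _)
      _ = Real.exp (-(|t| * B)) * (Real.exp (-(1 / g ^ 2 * a + Em * ((D.C ⟨κ K, F.m, g₀ (κ K)⟩).numSites (κ K) : ℝ))) *
            (fieldMeasure (F.P (κ K)) (κ K) G).real (S K)) := by rw [Real.exp_add, mul_assoc]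
      _ ≤ ∫ U, Real.exp (t * obs (κ K) U) * D.dens (κ K) (g₀ (κ K)) 0 U ∂fieldMeasure (F.P (κ K)) 0 G := hchain
      _ ≤ ∑ τ ∈ T K, A K t τ := hα K t ht hK
  nup_nonneg K t ht hK := (hnup K t ht hK).1
  ratio K t ht hK := by
    rw [constOf_mul_nlowOf (floorOf_pos hθ).ne']
    exact (hnup K t ht hK).2

/-- **★ THE FLOORED (G2)∕(G5) SOCKET FROM THE TOP-LEVEL LOWER HALF — bond-ball form** (`T4StabilityFloor.lowEnvelope_of_cor3With_ball` re-keyed): the core sets are the bond balls `Π_b B`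
of ONE measurable one-bond set `B ⊆ G` of positive Haar mass; their masses are all `haar(B)^{unitBondCount F}` (the floor module's `fieldMeasure_real_bondBall_top`), so the floor
is `c₀ = e^{−a∕g²}·haar(B)^{4(2L^m)⁴}`.  Remaining binders: ONE number `Em` + the top-level lower half, the endpoint `g_{κ K} = g`, (α), (P1), (P2), `hsites`, the numerator
envelope — nothing named `c_low`, no `Cor3With`. [cite: Balaban1988Convergent, Cor. 3 (2.50) p.264; Balaban1985UV3, (6) p.257; Balaban1987RG1, (0.1) p.251] -/
theorem lowEnvelope_of_lowerAtTop_ball (D : FiniteEpsData F G) (hsign : B16.SignConventions D.C) (κ : ℕ → ℕ) (g₀ : ℕ → ℝ) {g Em : ℝ} {K₀ : ℕ}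
    (hg : ∀ K, K₀ ≤ K → (D.C ⟨κ K, F.m, g₀ (κ K)⟩).flow.g (κ K) = g)
    (hlow : ∀ K, K₀ ≤ K → ∀ V : GaugeField (F.P (κ K)) (κ K) G,
      (D.C ⟨κ K, F.m, g₀ (κ K)⟩).χ (κ K) ((D.real.cfg (κ K) (g₀ (κ K)) (κ K)).symm V) *
          Real.exp (-(1 / ((D.C ⟨κ K, F.m, g₀ (κ K)⟩).flow.g (κ K)) ^ 2 *
              (D.C ⟨κ K, F.m, g₀ (κ K)⟩).wilsonBG (κ K) ((D.real.cfg (κ K) (g₀ (κ K)) (κ K)).symm V)) -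
            Em * ((D.C ⟨κ K, F.m, g₀ (κ K)⟩).numSites (κ K) : ℝ)) ≤ D.dens (κ K) (g₀ (κ K)) (κ K) V)
    {obs : (K : ℕ) → GaugeField (F.P K) 0 G → ℝ} {B l₀ : ℝ}
    (hobs : ∀ K, Measurable (obs K)) (hbd : ∀ K U, |obs K U| ≤ B)
    {ι : Type*} {T : ℕ → Finset ι} {A : ℕ → ℝ → ι → ℝ}
    (hα : ∀ K t, |t| ≤ l₀ → K₀ ≤ K →
      ∫ U, Real.exp (t * obs (κ K) U) * D.dens (κ K) (g₀ (κ K)) 0 U ∂fieldMeasure (F.P (κ K)) 0 G ≤ ∑ τ ∈ T K, A K t τ)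
    {Bset : Set G} (hB : MeasurableSet Bset) (hθ : 0 < (HaarData.haar (G := G)).real Bset) {a n₁ : ℝ}
    (hχ : ∀ K, K₀ ≤ K → ∀ V : GaugeField (F.P (κ K)) (κ K) G, (∀ b, V b ∈ Bset) →
      1 ≤ (D.C ⟨κ K, F.m, g₀ (κ K)⟩).χ (κ K) ((D.real.cfg (κ K) (g₀ (κ K)) (κ K)).symm V))
    (hA : ∀ K, K₀ ≤ K → ∀ V : GaugeField (F.P (κ K)) (κ K) G, (∀ b, V b ∈ Bset) →
      (D.C ⟨κ K, F.m, g₀ (κ K)⟩).wilsonBG (κ K) ((D.real.cfg (κ K) (g₀ (κ K)) (κ K)).symm V) ≤ a)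
    (hsites : ∀ K, K₀ ≤ K → ((D.C ⟨κ K, F.m, g₀ (κ K)⟩).numSites (κ K) : ℝ) ≤ n₁)
    {nup : ℕ → ℝ → ℝ} {Nup : ℝ} (hnup : ∀ K t, |t| ≤ l₀ → K₀ ≤ K → 0 ≤ nup K t ∧ nup K t ≤ Nup) :
    LowEnvelope l₀ T A (nlowOf l₀ B (max Em 0) n₁ (floorOf g a ((HaarData.haar (G := G)).real Bset ^ unitBondCount F))) nup
      (constOf l₀ B (max Em 0) n₁ (floorOf g a ((HaarData.haar (G := G)).real Bset ^ unitBondCount F)) Nup) K₀ :=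
  lowEnvelope_of_lowerAtTop_core D hsign κ g₀ hg hlow hobs hbd hα
    (S := fun K => bondBall (F.P (κ K)) (κ K) Bset) (fun _ => measurableSet_bondBall hB)
    (pow_pos hθ _) (fun K _ => (fieldMeasure_real_bondBall_top F (κ K) Bset).ge)
    (fun K hK V hV => hχ K hK V hV) (fun K hK V hV => hA K hK V hV) hsites hnup

end Generic

/-! ## §2 At NODE 00's Stage-13 datum of record: the socket from (L2ˢ) AT THE TOP LEVEL ONLY -/

section Record

variable {F : T4Family} {N : ℕ} [NeZero N] (θ : Stage13HParams F N) (h : θ.Provisos₁₃SepCoPH F N)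

/-- `K ≤ m + K` on the `K`-th torus, in `Params` letters (`(F.P K).K = K`, `(F.P K).m = m`). [cite: Balaban1987RG1, (0.1) p.251 (bookkeeping)] -/
theorem top_le_m_add_K (K : ℕ) : K ≤ (F.P K).m + (F.P K).K := by
  rw [T4Family.P_K, T4Family.P_m]; omega

/-- **THE TOP-LEVEL POINTWISE LOWER HALF AT THE RECORD FROM (L2ˢ) AT THE TOP LEVEL** — run `⟨K, m, g₀⟩`, level `k = K`, one number `Em`: if the all-small (2.18) term of record obeys
`χβ_K(V)·exp(−g_K⁻²A^η_K(V) − Em·|T₁^{(K)}|) ≤ χ_K(s₀)(V)·(𝐓_K e^{A_K})(s₀)(V)` at every `V` of the SMALL LOCUS (every `b₀`-free plaquette `(2εreg + 4ε₂₉)`-small), then the lower half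
of (2.50) holds at EVERY top-level `V` (off the locus the (2.9) species vanishes and `ρ_K ≥ 0`: dag-n13-w1 g2's `uvLower_of_smallLocus`; the other terms are `≥ 0`, `histTerm_nonneg`;
(2.18) holds by construction, `densOfRecord₁₃_eq_sum`).  `εreg` in [Av] Prop. 2's range. [cite: Balaban1988Convergent, (2.18) p.257, Cor. 3 (2.50) p.264; Balaban1987RG1, (2.9) p.266; Balaban1985Averaging, Prop. 2 (54) p.26] -/
theorem uvLowerTop_datumOfRecord₁₃SepCoPH_of_L2smallTop (hε : 0 < θ.ν.εreg) (hε3 : (143 * ((((4 + 4 : ℕ) : ℝ)) ^ 2 / 4) ^ 2) * θ.ν.εreg ≤ 1 / 3)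
    (hε2 : 2 * θ.ν.εreg ≤ 2 * deltaSU (Fin N) / ((((4 + 4) * F.L : ℕ) : ℝ) ^ 2)) (K : ℕ) (g₀ : ℝ) (Em : ℝ)
    (s₀ : (reprOfRecord₁₃ F N θ.toStage13Params ⟨K, F.m, g₀⟩ K).Adm)
    (hL2top : ∀ V : GaugeField (F.P K) K (SU N),
      (∀ p : Plaq (F.P K) K, ¬ IsB0 (F := F) (⟨p.src, p.μ⟩ : PBond (F.P K) K) → ¬ IsB0 (F := F) (⟨p.src.shift p.μ, p.ν⟩ : PBond (F.P K) K) →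
        ¬ IsB0 (F := F) (⟨p.src.shift p.ν, p.μ⟩ : PBond (F.P K) K) → ¬ IsB0 (F := F) (⟨p.src, p.ν⟩ : PBond (F.P K) K) →
        dist1 (GaugeField.plaqHol V p) < 2 * θ.ν.εreg + 4 * θ.ε₂₉) →
      chiβOfRecord₁₃ F N θ.toStage13Params K (gOfRecord₁₃ F N θ.toStage13Params ⟨K, F.m, g₀⟩) K V *
          Real.exp (-(1 / (gOfRecord₁₃ F N θ.toStage13Params ⟨K, F.m, g₀⟩ K) ^ 2 * wilsonBGOfRecord F N θ.εbg ⟨K, F.m, g₀⟩ K V)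
            - Em * (Fintype.card (Site (F.P K) K) : ℝ)) ≤
        (reprOfRecord₁₃ F N θ.toStage13Params ⟨K, F.m, g₀⟩ K).χ s₀ V * (reprOfRecord₁₃ F N θ.toStage13Params ⟨K, F.m, g₀⟩ K).TexpA s₀ V) :
    ∀ V : GaugeField (F.P K) K (SU N),
      ((datumOfRecord₁₃SepCoPH F N θ h).C ⟨K, F.m, g₀⟩).χ K (((datumOfRecord₁₃SepCoPH F N θ h).real.cfg K g₀ K).symm V) *
          Real.exp (-(1 / (((datumOfRecord₁₃SepCoPH F N θ h).C ⟨K, F.m, g₀⟩).flow.g K) ^ 2 *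
              ((datumOfRecord₁₃SepCoPH F N θ h).C ⟨K, F.m, g₀⟩).wilsonBG K (((datumOfRecord₁₃SepCoPH F N θ h).real.cfg K g₀ K).symm V)) -
            Em * (((datumOfRecord₁₃SepCoPH F N θ h).C ⟨K, F.m, g₀⟩).numSites K : ℝ)) ≤ (datumOfRecord₁₃SepCoPH F N θ h).dens K g₀ K V :=
  fun V =>
    uvLower_of_smallLocus θ.toStage13Params h.toCore.zetaUnity h.toCore.zetaAbs hε ⟨K, F.m, g₀⟩ (top_le_m_add_K K) hε3 hε2 Em
      (fun U hsmall => ge_of_sum_repr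
        (fun s => (reprOfRecord₁₃ F N θ.toStage13Params ⟨K, F.m, g₀⟩ K).χ s U * (reprOfRecord₁₃ F N θ.toStage13Params ⟨K, F.m, g₀⟩ K).TexpA s U) s₀
        (densOfRecord₁₃_eq_sum F N θ ⟨K, F.m, g₀⟩ K U) (fun s => histTerm_nonneg θ.toStage13Params h.toCore.zetaUnity h.toCore.zetaAbs ⟨K, F.m, g₀⟩ K s U)
        (hL2top U hsmall)) V

/-- **★★ THE LADDER'S (G2)∕(G5) SOCKET AT K1⁷'s RECORD FROM (L2ˢ) AT THE TOP LEVEL ONLY, WITH ONE NUMBER** — `LowEnvelope` for the Stage-13 datum `datumOfRecord₁₃SepCoPH θ h` along the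
runs `κ K`, `K ≥ K₀`, with bare couplings `g₀(κ K)`, from: the all-small term's lower bound (L2ˢ) AT THE FINAL LEVEL `k = κ K` on the small locus with ONE number `Em` (for all
`K ≥ K₀`), `εreg` in [Av] Prop. 2's range, and the socket's external binders (α) `hα`, (γ) `hfloor` (`0 < c₀`), numerator envelope `hnup`; the site budget is the `K`-uniform count
`|T₁^{(K)}| = (2L^m)⁴` and the sign convention K0e's `chiFix29OfRecord_mem_Icc` (both discharged inline, as in p597689).  Compare dag-n13-w3's `lowEnvelope_datumOfRecord₁₃SepCoPH_of_U1_U2_L2`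
(U1 + U2 + L2 at EVERY level on a window, a tuned family): the rung reads none of (U1), (U2), the levels `k < K`, the window or the tuning.  CONDITIONAL on the displayed
binders; nothing of Bałaban's asserted; K1⁷ NOT closed. [cite: Balaban1988Convergent, (2.18) p.257, Cor. 3 (2.50) p.264; Balaban1985UV3, (6) p.257; Balaban1989LargeFieldII, (0.1) pp.355–356; Balaban1987RG1, (0.1) p.251, (2.9) p.266; Balaban1985Averaging, Prop. 2 (54) p.26] -/
theorem lowEnvelope_datumOfRecord₁₃SepCoPH_of_L2smallTop (hε : 0 < θ.ν.εreg) (hε3 : (143 * ((((4 + 4 : ℕ) : ℝ)) ^ 2 / 4) ^ 2) * θ.ν.εreg ≤ 1 / 3)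
    (hε2 : 2 * θ.ν.εreg ≤ 2 * deltaSU (Fin N) / ((((4 + 4) * F.L : ℕ) : ℝ) ^ 2)) (κ : ℕ → ℕ) (g₀ : ℕ → ℝ) {Em : ℝ} {K₀ : ℕ}
    (s₀ : (K : ℕ) → (reprOfRecord₁₃ F N θ.toStage13Params ⟨κ K, F.m, g₀ (κ K)⟩ (κ K)).Adm)
    (hL2top : ∀ K, K₀ ≤ K → ∀ V : GaugeField (F.P (κ K)) (κ K) (SU N),
      (∀ p : Plaq (F.P (κ K)) (κ K), ¬ IsB0 (F := F) (⟨p.src, p.μ⟩ : PBond (F.P (κ K)) (κ K)) → ¬ IsB0 (F := F) (⟨p.src.shift p.μ, p.ν⟩ : PBond (F.P (κ K)) (κ K)) →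
        ¬ IsB0 (F := F) (⟨p.src.shift p.ν, p.μ⟩ : PBond (F.P (κ K)) (κ K)) → ¬ IsB0 (F := F) (⟨p.src, p.ν⟩ : PBond (F.P (κ K)) (κ K)) →
        dist1 (GaugeField.plaqHol V p) < 2 * θ.ν.εreg + 4 * θ.ε₂₉) →
      chiβOfRecord₁₃ F N θ.toStage13Params (κ K) (gOfRecord₁₃ F N θ.toStage13Params ⟨κ K, F.m, g₀ (κ K)⟩) (κ K) V *
          Real.exp (-(1 / (gOfRecord₁₃ F N θ.toStage13Params ⟨κ K, F.m, g₀ (κ K)⟩ (κ K)) ^ 2 * wilsonBGOfRecord F N θ.εbg ⟨κ K, F.m, g₀ (κ K)⟩ (κ K) V)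
            - Em * (Fintype.card (Site (F.P (κ K)) (κ K)) : ℝ)) ≤
        (reprOfRecord₁₃ F N θ.toStage13Params ⟨κ K, F.m, g₀ (κ K)⟩ (κ K)).χ (s₀ K) V *
          (reprOfRecord₁₃ F N θ.toStage13Params ⟨κ K, F.m, g₀ (κ K)⟩ (κ K)).TexpA (s₀ K) V)
    {obs : (K : ℕ) → GaugeField (F.P K) 0 (SU N) → ℝ} {B l₀ : ℝ}
    (hobs : ∀ K, Measurable (obs K)) (hbd : ∀ K U, |obs K U| ≤ B)
    {ι : Type*} {T : ℕ → Finset ι} {A : ℕ → ℝ → ι → ℝ}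
    (hα : ∀ K t, |t| ≤ l₀ → K₀ ≤ K →
      ∫ U, Real.exp (t * obs (κ K) U) * (datumOfRecord₁₃SepCoPH F N θ h).dens (κ K) (g₀ (κ K)) 0 U ∂fieldMeasure (F.P (κ K)) 0 (SU N) ≤ ∑ τ ∈ T K, A K t τ)
    {c₀ : ℝ} (hc₀ : 0 < c₀) (hfloor : ∀ K, K₀ ≤ K → c₀ ≤ smallFieldMass (datumOfRecord₁₃SepCoPH F N θ h) (κ K) (g₀ (κ K)))
    {nup : ℕ → ℝ → ℝ} {Nup : ℝ} (hnup : ∀ K t, |t| ≤ l₀ → K₀ ≤ K → 0 ≤ nup K t ∧ nup K t ≤ Nup) :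
    LowEnvelope l₀ T A (nlowOf l₀ B (max Em 0) ((2 * (F.L : ℝ) ^ F.m) ^ 4) c₀) nup (constOf l₀ B (max Em 0) ((2 * (F.L : ℝ) ^ F.m) ^ 4) c₀ Nup) K₀ :=
  lowEnvelope_of_lowerAtTop (datumOfRecord₁₃SepCoPH F N θ h) (fun p k V => (chiFix29OfRecord_mem_Icc θ.ν θ.ε₂₉ p.K k V).1) κ g₀
    (fun K hK => uvLowerTop_datumOfRecord₁₃SepCoPH_of_L2smallTop θ h hε hε3 hε2 (κ K) (g₀ (κ K)) Em (s₀ K) (hL2top K hK))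
    hobs hbd hα hc₀ hfloor
    (fun K _ => by
      show (Fintype.card (Site (F.P (κ K)) (κ K)) : ℝ) ≤ (2 * (F.L : ℝ) ^ F.m) ^ 4
      rw [Site.card_site]
      simp [Params.sitesPerDir, T4Family.P, Missing.params4])
    hnup

/-- **★★ THE FLOORED SOCKET AT K1⁷'s RECORD FROM (L2ˢ) AT THE TOP LEVEL — bond-ball form, EXPLICIT `K`-UNIFORM FLOOR**: as `lowEnvelope_datumOfRecord₁₃SepCoPH_of_L2smallTop`, with the
(γ) floor REPLACED by a measurable one-bond set `B ⊆ SU(N)` of positive Haar mass, a level `a`, the endpoint `g_{κ K} = g` of the runs, and the pointwise binders at the top level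
of the record (P1) `χβ_K ≥ 1` ∕ (P2) `A^η_K ≤ a` on its bond balls (the floor module's located binders, [Balaban1988Convergent] (2.17) ∕ [Balaban1985Variational] (2),(5),(8) —
DISPLAYED); floor `c₀ = e^{−a∕g²}·haar(B)^{4(2L^m)⁴}`. [cite: Balaban1988Convergent, (2.17)–(2.18) p.257, Cor. 3 (2.50) p.264; Balaban1985UV3, (6) p.257; Balaban1987RG1, (0.1) p.251, (2.9) p.266; Balaban1985Averaging, Prop. 2 (54) p.26] -/
theorem lowEnvelope_datumOfRecord₁₃SepCoPH_of_L2smallTop_ball (hε : 0 < θ.ν.εreg) (hε3 : (143 * ((((4 + 4 : ℕ) : ℝ)) ^ 2 / 4) ^ 2) * θ.ν.εreg ≤ 1 / 3)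
    (hε2 : 2 * θ.ν.εreg ≤ 2 * deltaSU (Fin N) / ((((4 + 4) * F.L : ℕ) : ℝ) ^ 2)) (κ : ℕ → ℕ) (g₀ : ℕ → ℝ) {g Em : ℝ} {K₀ : ℕ}
    (hg : ∀ K, K₀ ≤ K → gOfRecord₁₃ F N θ.toStage13Params ⟨κ K, F.m, g₀ (κ K)⟩ (κ K) = g)
    (s₀ : (K : ℕ) → (reprOfRecord₁₃ F N θ.toStage13Params ⟨κ K, F.m, g₀ (κ K)⟩ (κ K)).Adm)
    (hL2top : ∀ K, K₀ ≤ K → ∀ V : GaugeField (F.P (κ K)) (κ K) (SU N),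
      (∀ p : Plaq (F.P (κ K)) (κ K), ¬ IsB0 (F := F) (⟨p.src, p.μ⟩ : PBond (F.P (κ K)) (κ K)) → ¬ IsB0 (F := F) (⟨p.src.shift p.μ, p.ν⟩ : PBond (F.P (κ K)) (κ K)) →
        ¬ IsB0 (F := F) (⟨p.src.shift p.ν, p.μ⟩ : PBond (F.P (κ K)) (κ K)) → ¬ IsB0 (F := F) (⟨p.src, p.ν⟩ : PBond (F.P (κ K)) (κ K)) →
        dist1 (GaugeField.plaqHol V p) < 2 * θ.ν.εreg + 4 * θ.ε₂₉) →
      chiβOfRecord₁₃ F N θ.toStage13Params (κ K) (gOfRecord₁₃ F N θ.toStage13Params ⟨κ K, F.m, g₀ (κ K)⟩) (κ K) V *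
          Real.exp (-(1 / (gOfRecord₁₃ F N θ.toStage13Params ⟨κ K, F.m, g₀ (κ K)⟩ (κ K)) ^ 2 * wilsonBGOfRecord F N θ.εbg ⟨κ K, F.m, g₀ (κ K)⟩ (κ K) V)
            - Em * (Fintype.card (Site (F.P (κ K)) (κ K)) : ℝ)) ≤
        (reprOfRecord₁₃ F N θ.toStage13Params ⟨κ K, F.m, g₀ (κ K)⟩ (κ K)).χ (s₀ K) V *
          (reprOfRecord₁₃ F N θ.toStage13Params ⟨κ K, F.m, g₀ (κ K)⟩ (κ K)).TexpA (s₀ K) V)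
    {obs : (K : ℕ) → GaugeField (F.P K) 0 (SU N) → ℝ} {B l₀ : ℝ}
    (hobs : ∀ K, Measurable (obs K)) (hbd : ∀ K U, |obs K U| ≤ B)
    {ι : Type*} {T : ℕ → Finset ι} {A : ℕ → ℝ → ι → ℝ}
    (hα : ∀ K t, |t| ≤ l₀ → K₀ ≤ K →
      ∫ U, Real.exp (t * obs (κ K) U) * (datumOfRecord₁₃SepCoPH F N θ h).dens (κ K) (g₀ (κ K)) 0 U ∂fieldMeasure (F.P (κ K)) 0 (SU N) ≤ ∑ τ ∈ T K, A K t τ)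
    {Bset : Set (SU N)} (hB : MeasurableSet Bset) (hθB : 0 < (HaarData.haar (G := SU N)).real Bset) {a : ℝ}
    (hP1 : ∀ K, K₀ ≤ K → ∀ V : GaugeField (F.P (κ K)) (κ K) (SU N), (∀ b, V b ∈ Bset) →
      1 ≤ chiβOfRecord₁₃ F N θ.toStage13Params (κ K) (gOfRecord₁₃ F N θ.toStage13Params ⟨κ K, F.m, g₀ (κ K)⟩) (κ K) V)
    (hP2 : ∀ K, K₀ ≤ K → ∀ V : GaugeField (F.P (κ K)) (κ K) (SU N), (∀ b, V b ∈ Bset) →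
      wilsonBGOfRecord F N θ.εbg ⟨κ K, F.m, g₀ (κ K)⟩ (κ K) V ≤ a)
    {nup : ℕ → ℝ → ℝ} {Nup : ℝ} (hnup : ∀ K t, |t| ≤ l₀ → K₀ ≤ K → 0 ≤ nup K t ∧ nup K t ≤ Nup) :
    LowEnvelope l₀ T A (nlowOf l₀ B (max Em 0) ((2 * (F.L : ℝ) ^ F.m) ^ 4) (floorOf g a ((HaarData.haar (G := SU N)).real Bset ^ unitBondCount F))) nup
      (constOf l₀ B (max Em 0) ((2 * (F.L : ℝ) ^ F.m) ^ 4) (floorOf g a ((HaarData.haar (G := SU N)).real Bset ^ unitBondCount F)) Nup) K₀ :=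
  lowEnvelope_of_lowerAtTop_ball (datumOfRecord₁₃SepCoPH F N θ h) (fun p k V => (chiFix29OfRecord_mem_Icc θ.ν θ.ε₂₉ p.K k V).1) κ g₀ hg
    (fun K hK => uvLowerTop_datumOfRecord₁₃SepCoPH_of_L2smallTop θ h hε hε3 hε2 (κ K) (g₀ (κ K)) Em (s₀ K) (hL2top K hK))
    hobs hbd hα hB hθB (fun K hK V hV => hP1 K hK V hV) (fun K hK V hV => hP2 K hK V hV)
    (fun K _ => by
      show (Fintype.card (Site (F.P (κ K)) (κ K)) : ℝ) ≤ (2 * (F.L : ℝ) ^ F.m) ^ 4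
      rw [Site.card_site]
      simp [Params.sitesPerDir, T4Family.P, Missing.params4])
    hnup

end Record

end Summit.QuantumFields.YangMills.BalabanUVNodes.N13StabilitySocketOfTopLevelLowerAtRecord13SepCoPH

end
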